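import Literature.NumberTheory.LFunctions.Zhang2022.KnifeEdgeLenZDegreeAtoms

/-!
# Zhang (2022), rung F-S3 (Landau–Siegel programme, §D edge len = E*-len⁺): route `ZDegreeToeplitzBand`, item α1 —
# the TYPE of the ψ-graded closed-form tables (`PsiGradedClosedForms`): three finite sums of explicit sesquilinear
# profile-integral atoms (`KnifeEdgeLenZDegreeAtoms`), the three named projections `X₁psi`, `Y₁psi`, `X₂psiDiag`, and every
# shape check of the critic's C1 template PROVED once for every inhabitant (variance, junk guard, kernel-row hooks)

Y. Zhang, *Discrete mean estimates and the Landau–Siegel zero*, arXiv:2211.02515v1 [Zhang2022LandauSiegel] — an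
unrefereed manuscript under adjudication. **WHAT THIS IS NOT: not a claim about Theorems 1–2 of arXiv:2211.02515, about
Landau–Siegel zeros, or about Parity. The programme SEARCHES and TYPES; no claim about Landau–Siegel zeros, Theorems 1–2
of arXiv:2211.02515 or a repaired Margin232 until a kernel theorem says so.** Nothing in this file asserts that any table
IS the main term of any discrete mean: that is the content of the route's α2 items (`KnifeEdge.CrossTablePsi`,
`DualCrossTablePsi`, `TauTwoTablePsi` over a named instance) and of the K1″ derivation.

WHY A TYPE AND NOT THREE DEFINITIONS (typer's finding, ls-knife-typer-1 g6, 2026-08-27, reported to the cell before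
typing): the definition item `defn-PsiGradedClosedForms` asks for «closed-form `X₁psi Y₁psi X₂psiDiag` per F2-conversion-note
§3 + archimedean census». The F2 note (ls-knife-len-idea-1, `HOME/knife/len/idea-1/F2-conversion-note.md`) fixes the
MECHANISM — the degree-`d` ψ-graded entry is `Θ^{(d)} + conj Θ^{(−d)}` (graded Lemma 8.1, tree
`KnifeEdge.GradedLemma81`), the `e ≤ 0` halves are `Kl_{1−e}`-correlations (`KnifeEdgeLenZDegree.familyGaussMoment_holds`),
the `|d| = 2` diagonal is the family `h·n = r` of a `(μ∗χb) ⊗ d₃` bilinear form — but, in its own words, «archimedean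
normalisations NOT pinned here»: no kernel of any of the three tables has been derived by anyone (the census was never
posted; the critic ls-knife-crit-1 2026-08-27T04:40:02Z: «the α1 forms are OUTPUTS of the K1″ derivation»). A definition
seat cannot transcribe a formula that does not exist, and must not invent one (a filler kernel would be set-signature'd into
the α2/α3 items and certify nothing). What DOES type today is the SHAPE CLASS the derivation's output must lie in, with
all of the critic's acceptance checks (C1 template items 2(b)(b′)(b″), 4(iii), 12) discharged uniformly:

* Atoms (companion leaf `KnifeEdgeLenZDegreeAtoms`): `localPair`, `antilocalPair`, `volterraPair`, `leftIntegralPoint₂`,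
  `pointRightIntegral₂` + the `KnifeEdgeLenZDegreeKernels` shapes; `ClosedFormAtom` (seven constructors), `ClosedFormAtom.eval`,
  `ClosedFormAtom.KernelsContinuous` (kernels `ContinuousOn` the CLOSED interval / square, marked points in `[0,1]` — the
  critic's pin (b″); honest-integral lemma `intervalIntegrable_localPair_integrand`), `ClosedForm := List ClosedFormAtom`,
  `ClosedForm.eval`, `pairHomogeneous_closedForm_eval`.
* This leaf — **`PsiGradedClosedForms`**: three closed forms `x₁ y₁ x₂` + their continuity certificates; the projections
  `E.X₁psi := conjLeft E.x₁.eval`, `E.Y₁psi := E.y₁.eval`, `E.X₂psiDiag := conjLeft E.x₂.eval` (the CROSS slots are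
  conjugate-homogeneous in both pieces, the DUAL slot is `PairHomogeneous` — the variance of record,
  `KnifeEdgeLenZDegreeSlotTypes` Part 2 / critic 04:55:27Z); PROVED ∀ `E`: `pairConjHomogeneous_X₁psi/_X₂psiDiag`,
  `pairHomogeneous_Y₁psi`, `vanishesOnZero_X₁psi/_Y₁psi/_X₂psiDiag`; the named checks the instance must pass or ring:
  `E.SymmAsFormulas` (cross forms symmetric under the swap of the two pieces — `crossTablePsi_symm_of_notA_io`; an
  asymmetric instance with its slot is BY ITSELF Theorem 1: `theorem1_of_not_symm₁/₂`), `E.GStarRowsDark` (the S0′ kernel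
  rows at Zhang's kernel mode `g⋆`; a live row is α3 ∧ ¬GradedPSD at once: `kernelRow_switch₂/₁`), and the route's
  endgame over the projections (`theorem1_of_slots`, `gradedPSD_of_slots_of_notA_io'`).

PROVENANCE / C1-prep (q1)–(q4), the part decidable WITHOUT an instance (critic file C1-prep-provenance v1.4): (q2) SUPPORT,
read off the F2 bookkeeping per degree — on `σ = 3/2` the `κ`-variable of `𝔠(s,ψ)` is untruncated whatever (7.2) says of the
data, so the paired lengths are `m ≲ (pt₀)^{1−e}·n`: degree 0 ⇒ support 2 (Zhang's reciprocity step handles it exactly,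
Prop 7.1 p.14); degree ±1 ⇒ the `Kl₂` half has `m ≲ (pt₀)²n ≍ P³`, support 3 > 2 (so the degree-1 entries have their OWN
exact-class / wrap split after Voronoi in the `d₂`-variable — they are not «inside (7.2)»); degree ±2 ⇒ `m ≲ (pt₀)³n ≍ P⁴`,
support 4 (F2 §3). (q3)/(q4): the lattice model's Z-twisted expectations `X₁^𝕄, Y₁^𝕄, X₂^𝕄` and the two model numbers of
the degree-2 wrap, `wrap^𝕄_mean` (class mean) and `wrap^𝕄_fluct` (the complete `θ`-sum of lattice moments × Gauss phases), are
NOT YET COMPUTED by anyone (ls-theory 2026-08-27T06:58:10Z: «no seat holds an evaluated degree-2 / Z-twisted model expectation»;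
critic memo C1-prep v1.6 (R3″)) — booked as the K-len knife-edge entry, not a wall; their computation is a K1″a / numerics
deliverable. (q1) is a question about an instance and is open until one exists.
INSTANCE PROTOCOL: the K1″a hand (route item `TauTwoSlotExplicit`, `KnifeEdge.DiagMain`) lands a term
`E₀ : PsiGradedClosedForms` next to its derivation, with a per-atom derivation pointer in the docstring (which mean, which
exact class, which display of §7–§9 / F2 §1–3); the α2/α3 items are then set over `E₀.X₁psi`, `E₀.Y₁psi`, `E₀.X₂psiDiag`.

PART 2 (appended 2026-08-27 by ls-knife-typer-1 g6, answering the critic's pre-registered reading (P3) «symmetry as a FIELD» while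
keeping the bare type alarm-capable): `SymmetricPsiGradedClosedForms` EXTENDS the record by the two swap laws of the cross tables
as FIELDS (`symm₁`, `symm₂`); an instance built there satisfies `SymmAsFormulas` by construction (`symmAsFormulas`), and the α-items
may be set over either presentation (`E.toPsiGradedClosedForms.X₁psi` unfolds to the same atoms). The bare `PsiGradedClosedForms`
stays the type of a derivation output whose symmetry is NOT yet checked — so that an asymmetric output can still be typed and ring
`theorem1_of_not_symm₁/₂` instead of being unconstructible. Why symmetry is the only check offered as a field: it is a CONSISTENCY law
of the slots (`crossTablePsi_symm_of_notA_io`), not a B-AH prediction; kernel-row darkness / Gram factorisations stay named Props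
(`GStarRowsDark`) and are never fields (they are what the α3 cell tests).

Typer: ls-knife-typer-1 g6 (cell landau-siegel §D).

## References
* Y. Zhang, arXiv:2211.02515v1 (2022), §2 (2.16)–(2.17); §7 Prop. 7.1 (7.2), p.14; §8 (8.5), Lemma 8.1; §9.
  [cite: Zhang2022LandauSiegel, §2 (2.16)–(2.17), §7 Prop 7.1 (7.2), §8 (8.5) Lemma 8.1, §9]
-/

noncomputable section

open Complex Real ComplexConjugate Set

namespace Literature.NumberTheory.LFunctions.Zhang2022.KnifeEdge

open Repair Skeleton

/-! ### The TYPE `PsiGradedClosedForms`, the named projections, and the C1 checks as theorems / named Props -/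

/-- **ψ-GRADED CLOSED-FORM TABLES (the type of the route's α1 object).** Three explicit closed forms — for the degree-1
CROSS entry `(1,0)`, the degree-1 DUAL entry `(2,1)` and the DIAGONAL FAMILY `h·n = r` of the degree-2 entry `(2,0)` of the
ψ-graded Gram table of (2.16) — each a finite sum of fixed-kernel sesquilinear atoms with kernels continuous on the closed
domain. NO INSTANCE IS ASSERTED OR DEFINED HERE: the instance `E₀` is the output of the K1″ derivation (F2 note §1–3: graded
Lemma 8.1, right edge `σ = 3/2`, family Gauss moment `Kl_{1−e}`, exact class; route items α2-deg1/α2-deg2) and lands with it.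
[cite: Zhang2022LandauSiegel, §2 (2.16)–(2.17), §8 (8.5) Lemma 8.1, §9] -/
structure PsiGradedClosedForms : Type where
  /-- atoms of the degree-1 cross table (before leg-0 conjugation) -/
  x₁ : ClosedForm
  /-- atoms of the degree-1 dual table -/
  y₁ : ClosedForm
  /-- atoms of the degree-2 diagonal-family table (before leg-0 conjugation) -/
  x₂ : ClosedForm
  /-- pin (b″): kernels of `x₁` continuous on the closed domain -/
  cont_x₁ : ClosedForm.KernelsContinuous x₁
  /-- pin (b″): kernels of `y₁` continuous on the closed domain -/
  cont_y₁ : ClosedForm.KernelsContinuous y₁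
  /-- pin (b″): kernels of `x₂` continuous on the closed domain -/
  cont_x₂ : ClosedForm.KernelsContinuous x₂

namespace PsiGradedClosedForms

variable (E : PsiGradedClosedForms)

/-- **`X₁psi`** — the closed-form table of the ψ-graded degree-1 CROSS slot `CrossTablePsi c′ 1` (`Σ Re𝔠*·Z(ρ,ψ)·conj Q_g·conj H_f·Reω
≈ X₁(f,g)·𝔞𝔓`): the leg-0 conjugate of the closed form `E.x₁` (conjugate-homogeneous in BOTH pieces, the slot's variance).
[cite: Zhang2022LandauSiegel, §8 (8.5), Lemma 8.1, §9] -/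
def X₁psi : PairFunctional := conjLeft (ClosedForm.eval E.x₁)

/-- **`Y₁psi`** — the closed-form table of the ψ-graded degree-1 DUAL slot `DualCrossTablePsi c′ 1`
(`Σ Re𝔠*·Z(ρ,ψ)·conj Q_{g₂}·Q_{g₁}·Reω ≈ Y₁(g₁,g₂)·𝔞𝔓`): the closed form `E.y₁` itself (linear in `g₁`, conjugate-linear in `g₂`).
[cite: Zhang2022LandauSiegel, §2 (2.17), §8 (8.5)] -/
def Y₁psi : PairFunctional := ClosedForm.eval E.y₁

/-- **`X₂psiDiag`** — the closed-form table of the DIAGONAL FAMILY `h·n = r` of the ψ-graded degree-2 slot (K1″a's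
`DiagMain T_diag X₂`; the wrap `h·n ≡ r (mod p), h·n ≠ r` is K1″b's `WrapNegligible`, not part of this table): the leg-0
conjugate of `E.x₂`. [cite: Zhang2022LandauSiegel, §8 (8.5), Lemma 8.1] -/
def X₂psiDiag : PairFunctional := conjLeft (ClosedForm.eval E.x₂)

/-- unfolding (the α3 engine's replay lemma): `X₁psi` is `E.x₁` evaluated on the conjugated first piece.
[cite: Zhang2022LandauSiegel, §8 (8.5)] -/
theorem X₁psi_apply (f f' g g' : ℝ → ℂ) :
    E.X₁psi f f' g g' = ClosedForm.eval E.x₁ (fun x => conj (f x)) (fun x => conj (f' x)) g g' := rfl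

/-- unfolding: `Y₁psi` is `E.y₁` evaluated as is. [cite: Zhang2022LandauSiegel, §2 (2.17)] -/
theorem Y₁psi_apply (g₁ g₁' g₂ g₂' : ℝ → ℂ) : E.Y₁psi g₁ g₁' g₂ g₂' = ClosedForm.eval E.y₁ g₁ g₁' g₂ g₂' := rfl

/-- unfolding: `X₂psiDiag` is `E.x₂` evaluated on the conjugated first piece; in particular the `g⋆`-row (ALPHA3-CELL S0′)
is the explicit value `ClosedForm.eval E.x₂ (conj ∘ g⋆) (conj ∘ g⋆′) g g′`, `g⋆ = e^{−iπy} + e^{−2iπy}` (`Repair.gStar`).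
[cite: Zhang2022LandauSiegel, §8 (8.5)] -/
theorem X₂psiDiag_apply (f f' g g' : ℝ → ℂ) :
    E.X₂psiDiag f f' g g' = ClosedForm.eval E.x₂ (fun x => conj (f x)) (fun x => conj (f' x)) g g' := rfl

/-- C1 item 12 / pin (b) for the cross table: `X₁psi` is conjugate pair-homogeneous. [cite: Zhang2022LandauSiegel, §8 (8.5)] -/
theorem pairConjHomogeneous_X₁psi : PairConjHomogeneous E.X₁psi :=
  pairConjHomogeneous_conjLeft_closedForm_eval E.x₁

/-- C1 item 12 / pin (b) for the NEW table: `X₂psiDiag` is conjugate pair-homogeneous. [cite: Zhang2022LandauSiegel, §8 (8.5)] -/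
theorem pairConjHomogeneous_X₂psiDiag : PairConjHomogeneous E.X₂psiDiag :=
  pairConjHomogeneous_conjLeft_closedForm_eval E.x₂

/-- C1 item 12 / pin (b) for the dual table: `Y₁psi` is pair-homogeneous. [cite: Zhang2022LandauSiegel, §2 (2.17)] -/
theorem pairHomogeneous_Y₁psi : PairHomogeneous E.Y₁psi :=
  pairHomogeneous_closedForm_eval E.y₁

/-- Junk guard for `X₁psi`. [cite: Zhang2022LandauSiegel, §7 Prop 7.1 (7.2)] -/
theorem vanishesOnZero_X₁psi : VanishesOnZero E.X₁psi :=
  vanishesOnZero_of_pairConjHomogeneous E.pairConjHomogeneous_X₁psi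

/-- Junk guard for `Y₁psi`. [cite: Zhang2022LandauSiegel, §7 Prop 7.1 (7.2)] -/
theorem vanishesOnZero_Y₁psi : VanishesOnZero E.Y₁psi :=
  vanishesOnZero_of_pairHomogeneous E.pairHomogeneous_Y₁psi

/-- Junk guard for `X₂psiDiag`. [cite: Zhang2022LandauSiegel, §7 Prop 7.1 (7.2)] -/
theorem vanishesOnZero_X₂psiDiag : VanishesOnZero E.X₂psiDiag :=
  vanishesOnZero_of_pairConjHomogeneous E.pairConjHomogeneous_X₂psiDiag

/-- **C1 item 4(iii), SYMMETRY AS FORMULAS (named check on the instance):** both cross tables are symmetric under the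
swap of the two pieces — what the slots force on the (A)-recurrent horn (`crossTablePsi_symm_of_notA_io`); an instance
failing it with its slot in hand rings the derivation alarm (`theorem1_of_not_symm₁/₂`). [cite: Zhang2022LandauSiegel, §8 (8.5)] -/
def SymmAsFormulas : Prop :=
  (∀ f f' g g' : ℝ → ℂ, E.X₁psi f f' g g' = E.X₁psi g g' f f') ∧
    ∀ f f' g g' : ℝ → ℂ, E.X₂psiDiag f f' g g' = E.X₂psiDiag g g' f f'

/-- **ALPHA3-CELL S0′, the KERNEL ROWS at Zhang's kernel mode `g⋆` (named check on the instance):** `X₁psi(g⋆,·)`,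
`X₂psiDiag(g⋆,·)` and both `Y₁psi` rows at `g⋆` vanish on every in-class piece (`𝔅(g⋆) = 0`, `Repair.mainTermForm_gStar`;
the barrier twin `GradedPSD` forces exactly this, `tables_eq_zero_on_gStar_of_gradedPSD`; one live row is α3 at once,
`kernelRow_switch₂/₁`). [cite: Zhang2022LandauSiegel, §2 (2.16), §7 Prop 7.1] -/
def GStarRowsDark : Prop :=
  ∀ g g' : ℝ → ℂ, InClassPiece g g' →
    E.X₁psi gStar gStar' g g' = 0 ∧ E.X₂psiDiag gStar gStar' g g' = 0 ∧
      E.Y₁psi gStar gStar' g g' = 0 ∧ E.Y₁psi g g' gStar gStar' = 0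

variable {E} {c' : ℝ}

/-- The derivation alarm for the degree-1 cross table: with its slot, an asymmetric value on ONE in-class pair is by itself
Theorem 1 (`theorem1_of_crossTablePsi_asymm`). [cite: Zhang2022LandauSiegel, §1 Theorem 1, §8 (8.5)] -/
theorem theorem1_of_not_symm₁ (h : CrossTablePsi c' 1 E.X₁psi) {f f' g g' : ℝ → ℂ} (hf : InClassPiece f f')
    (hg : InClassPiece g g') (hne : E.X₁psi f f' g g' ≠ E.X₁psi g g' f f') : Theorem1 :=
  theorem1_of_crossTablePsi_asymm h hf hg hne

/-- … and for the NEW table. [cite: Zhang2022LandauSiegel, §1 Theorem 1, §8 (8.5)] -/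
theorem theorem1_of_not_symm₂ (h : TauTwoTablePsi c' E.X₂psiDiag) {f f' g g' : ℝ → ℂ} (hf : InClassPiece f f')
    (hg : InClassPiece g g') (hne : E.X₂psiDiag f f' g g' ≠ E.X₂psiDiag g g' f f') : Theorem1 :=
  theorem1_of_crossTablePsi_asymm h hf hg hne

/-- **S0′ switch for the NEW table:** one live `g⋆`-row value closes α3 (`GradedCloses`) and refutes the barrier twin
(`kernelRow_switch`). [cite: Zhang2022LandauSiegel, §2 (2.16), §7 Prop 7.1] -/
theorem kernelRow_switch₂ {g₂ g₂' : ℝ → ℂ} (hg₂ : InClassPiece g₂ g₂') (hX : E.X₂psiDiag gStar gStar' g₂ g₂' ≠ 0) :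
    GradedCloses E.X₁psi E.Y₁psi E.X₂psiDiag ∧ ¬ GradedPSD E.X₁psi E.Y₁psi E.X₂psiDiag :=
  kernelRow_switch hg₂ hX

/-- … and for the degree-1 cross table (`kernelRow_switch₁`). [cite: Zhang2022LandauSiegel, §2 (2.16), §7 Prop 7.1] -/
theorem kernelRow_switch₁' {g₁ g₁' : ℝ → ℂ} (hg₁ : InClassPiece g₁ g₁') (hX : E.X₁psi gStar gStar' g₁ g₁' ≠ 0) :
    GradedCloses E.X₁psi E.Y₁psi E.X₂psiDiag ∧ ¬ GradedPSD E.X₁psi E.Y₁psi E.X₂psiDiag :=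
  kernelRow_switch₁ hg₁ hX

/-- The barrier twin forces the `g⋆` rows of both cross tables dark (read contrapositively: the first α3 test).
[cite: Zhang2022LandauSiegel, §2 (2.16), §7 Prop 7.1] -/
theorem gStar_rows_of_gradedPSD (hP : GradedPSD E.X₁psi E.Y₁psi E.X₂psiDiag) {g₁ g₁' g₂ g₂' : ℝ → ℂ}
    (hg₁ : InClassPiece g₁ g₁') (hg₂ : InClassPiece g₂ g₂') :
    E.X₁psi gStar gStar' g₁ g₁' = 0 ∧ E.X₂psiDiag gStar gStar' g₂ g₂' = 0 :=
  tables_eq_zero_on_gStar_of_gradedPSD hP hg₁ hg₂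

/-- **The route's endgame over the projections** (tree `theorem1_of_gradedClosesPsi`): side tables ∧ the three ψ-graded slots
for `E` ∧ a non-PSD design for `E` ∧ Prop 2.2 (i) ∧ Lemma 2.3 ⇒ Theorem 1. Every hypothesis OPEN / a CLAIM.
[cite: Zhang2022LandauSiegel, §1 Theorem 1, §2 (2.16)] -/
theorem theorem1_of_slots (h0 : InClassMean c') (h1 : CrossTablePsi c' 1 E.X₁psi) (h21 : DualCrossTablePsi c' 1 E.Y₁psi)
    (h2 : TauTwoTablePsi c' E.X₂psiDiag) (hC : GradedCloses E.X₁psi E.Y₁psi E.X₂psiDiag) (h22 : Prop22i)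
    (h23 : Lemma23 c') : Theorem1 :=
  theorem1_of_gradedClosesPsi h0 h1 h21 h2 hC h22 h23

/-- **The barrier horn over the projections** (tree `gradedPSD_of_slots_of_notA_io`): if (A)-characters recur, the slots for `E`
make `E`'s graded main-term matrix PSD on every in-class design — the critic's (†) in kernel form for THIS instance type.
[cite: Zhang2022LandauSiegel, §2 (2.16), Lemma 2.3, Prop 2.2 (i)] -/
theorem gradedPSD_of_slots_of_notA_io' (h0 : InClassMean c') (h22 : Prop22i) (h23 : Lemma23 c')
    (h1 : CrossTablePsi c' 1 E.X₁psi) (h21 : DualCrossTablePsi c' 1 E.Y₁psi) (h2 : TauTwoTablePsi c' E.X₂psiDiag)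
    (hA : ¬ ForAllLarge fun D _ χ => ¬ AssumptionA D χ) : GradedPSD E.X₁psi E.Y₁psi E.X₂psiDiag :=
  gradedPSD_of_slots_of_notA_io h0 h22 h23 h1 h21 h2 hA

end PsiGradedClosedForms

/-! ### Part 2 — the SYMMETRIC presentation (swap laws of the cross tables as fields; the bare type stays alarm-capable) -/

/-- **ψ-graded closed-form tables WITH the swap symmetry of the two cross tables as fields** (critic's C1 reading (P3)):
`X₁psi(f,f′;g,g′) = X₁psi(g,g′;f,f′)` and the same for `X₂psiDiag`, for ALL legs. An honest derivation output is expected to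
land here (the slots force the law on in-class legs, `crossTablePsi_symm_of_notA_io`); one that cannot prove the two fields lands in
the bare type and rings `PsiGradedClosedForms.theorem1_of_not_symm₁/₂`. No instance is defined. [cite: Zhang2022LandauSiegel, §8 (8.5)] -/
structure SymmetricPsiGradedClosedForms : Type extends PsiGradedClosedForms where
  /-- swap law of the degree-1 cross table, as a formula -/
  symm₁ : ∀ f f' g g' : ℝ → ℂ,
    toPsiGradedClosedForms.X₁psi f f' g g' = toPsiGradedClosedForms.X₁psi g g' f f'
  /-- swap law of the degree-2 diagonal-family table, as a formula -/
  symm₂ : ∀ f f' g g' : ℝ → ℂ,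
    toPsiGradedClosedForms.X₂psiDiag f f' g g' = toPsiGradedClosedForms.X₂psiDiag g g' f f'

namespace SymmetricPsiGradedClosedForms

/-- A symmetric record passes the named check `SymmAsFormulas` by construction. [cite: Zhang2022LandauSiegel, §8 (8.5)] -/
theorem symmAsFormulas (E : SymmetricPsiGradedClosedForms) : E.toPsiGradedClosedForms.SymmAsFormulas :=
  ⟨E.symm₁, E.symm₂⟩

/-- … so on a symmetric record the asymmetry alarm cannot ring: the swap defect of `X₁psi` is identically zero.
[cite: Zhang2022LandauSiegel, §8 (8.5)] -/
theorem X₁psi_swap_sub (E : SymmetricPsiGradedClosedForms) (f f' g g' : ℝ → ℂ) :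
    E.toPsiGradedClosedForms.X₁psi f f' g g' - E.toPsiGradedClosedForms.X₁psi g g' f f' = 0 :=
  sub_eq_zero.mpr (E.symm₁ f f' g g')

/-- … and the same for `X₂psiDiag`. [cite: Zhang2022LandauSiegel, §8 (8.5)] -/
theorem X₂psiDiag_swap_sub (E : SymmetricPsiGradedClosedForms) (f f' g g' : ℝ → ℂ) :
    E.toPsiGradedClosedForms.X₂psiDiag f f' g g' - E.toPsiGradedClosedForms.X₂psiDiag g g' f f' = 0 :=
  sub_eq_zero.mpr (E.symm₂ f f' g g')

end SymmetricPsiGradedClosedForms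

end Literature.NumberTheory.LFunctions.Zhang2022.KnifeEdge

end
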